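import Mathlib
import Literature.NumberTheory.EllipticCurves.Smith2016.CongruentNumberGenusDeterminantHolds
import Literature.NumberTheory.EllipticCurves.Smith2016.CongruentNumberGenusDeterminantConsequences

/-!
# Tian–Yuan–Zhang's Theorem 1.2 on `n ≡ 1 (mod 8)` and Smith's Theorem 1.2 — now UNCONDITIONAL (resp. relative to TYZ Thm 1.1 only)

With `smith_thm22_rowOne_holds` (`CongruentNumberGenusDeterminantHolds`: Smith 2016 Thm. 2.2 row 1,
`ℒ₁(n) = det M₁`, proved for every number of prime factors via the bipartite all-minors forest
formula), the theorems of `CongruentNumberGenusDeterminantConsequences` that were stated RELATIVE to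
the named fact `smith_thm22_rowOne` become tree theorems [Smith2016CongruentDensity, Thm. 1.2,
Thm. 2.2, §4 Thm. 4.1 / Cor. 4.2; TianYuanZhang2017, Thm. 1.2 (journal numbering)]:
for every square-free `N ≡ 1 (mod 8)`,
`rank E_N(ℚ) = 0 ∧ Ш(E_N/ℚ)[2^∞] = 0 ⟺ #Sel⁽²⁾(E_N/ℚ) = 4 ⟺ Σ_{N = d₀⋯d_ℓ, dᵢ ≡ 1 (8)} ∏ g(dᵢ)` is odd
(no `L`-function anywhere: Monsky's exact formula, the descent count both ways, Rédei–Reichardt and the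
forest formula are all tree theorems), and Smith's own Theorem 1.2 (`𝓛(n)` odd `⟺ #Sel₂ = 4`) holds
relative to Tian–Yuan–Zhang's Theorem 1.1 (`thm11_parity_of_scriptL`) alone.
-/

namespace Literature.NumberTheory.EllipticCurves.Smith2016

open _root_.Matrix Literature.NumberTheory.EllipticCurves.HeathBrown1994
open Literature.NumberTheory.EllipticCurves.TianYuanZhang2017

variable {k : ℕ} (p : Fin k → ℕ)

/-- **`ℒ₁(n)` odd `⟺ det M₁ = 1`** for `n = p₁⋯p_k ≡ 1 (mod 8)`, unconditionally.
[cite: Smith2016CongruentDensity, Thm. 2.2 row 1 (chunk p0005 L59–L63)] -/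
theorem odd_genusSum₁_iff_det_smithMatrixOne (hp : ∀ i, (p i).Prime) (hodd : ∀ i, Odd (p i))
    (hinj : Function.Injective p) (h8 : (∏ i, p i) % 8 = 1) :
    Odd (genusSum₁ (∏ i, p i) fun d => genusClassNumber (GenusField d)) ↔
      (Matrix.fromBlocks (legendreMatrix p + (legendreMatrix p)ᵀ) (legendreMatrix p)ᵀ
        (legendreMatrix p) (legendreDiagonal p 2)).det = 1 :=
  odd_genusSum₁_iff_det_of_smith p smith_thm22_rowOne_holds hp hodd hinj h8

/-- **Tian–Yuan–Zhang (journal) Theorem 1.2 on `n ≡ 1 (mod 8)` = Smith Thm. 4.1 / Cor. 4.2, for every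
number of prime factors, UNCONDITIONALLY**: for `n = p₁⋯p_k ≡ 1 (mod 8)` a product of distinct odd
primes, `rank E⁽ⁿ⁾(ℚ) = 0 ∧ Ш(E⁽ⁿ⁾/ℚ)[2^∞] = 0 ⟺ Σ_{n = d₀⋯d_ℓ, dᵢ ≡ 1 (8)} ∏ᵢ g(dᵢ)` is odd.
[cite: TianYuanZhang2017, Thm. 1.2 (journal numbering: Smith Thm. 4.1 / Cor. 4.2)]
[cite: Smith2016CongruentDensity, Thm. 1.2 and Thm. 2.2] -/
theorem rank_zero_and_sha_iff_odd_genusSum₁ (hp : ∀ i, (p i).Prime) (hodd : ∀ i, Odd (p i))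
    (hinj : Function.Injective p) (h8 : (∏ i, p i) % 8 = 1) :
    ((haveI := isElliptic_congruentNumberCurve (Squarefree.ne_zero (squarefree_prod_of_injective p hp hinj));
        (congruentNumberCurve (∏ i, p i)).mordellWeilRank = 0) ∧
      (haveI := isElliptic_congruentNumberCurve (Squarefree.ne_zero (squarefree_prod_of_injective p hp hinj));
        AddCommGroup.primaryComponent (congruentNumberCurve (∏ i, p i)).sha 2 = ⊥)) ↔
      Odd (genusSum₁ (∏ i, p i) fun d => genusClassNumber (GenusField d)) :=
  rank_zero_and_sha_iff_odd_genusSum₁_of_smith p smith_thm22_rowOne_holds hp hodd hinj h8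

/-- **`#Sel⁽²⁾(E⁽ⁿ⁾/ℚ) = 4 ⟺ Σ∏g(dᵢ)` odd**, `n = p₁⋯p_k ≡ 1 (mod 8)`, unconditionally.
[cite: Smith2016CongruentDensity, §2 proof of Thm. 1.2 (chunk p0005 L65–L75)] -/
theorem card_selmerGroup_two_eq_four_iff_odd_genusSum₁ (hp : ∀ i, (p i).Prime)
    (hodd : ∀ i, Odd (p i)) (hinj : Function.Injective p) (h8 : (∏ i, p i) % 8 = 1) :
    Nat.card ((congruentNumberCurve (∏ i, p i)).selmerGroup 2) = 4 ↔
      Odd (genusSum₁ (∏ i, p i) fun d => genusClassNumber (GenusField d)) :=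
  card_selmerGroup_two_eq_four_iff_odd_genusSum₁_of_smith p smith_thm22_rowOne_holds hp hodd hinj h8

/-- **TYZ Theorem 1.2 on `n ≡ 1 (mod 8)` for EVERY square-free `N`, unconditionally**:
`rank E_N(ℚ) = 0 ∧ Ш(E_N/ℚ)[2^∞] = 0 ⟺ Σ∏g(dᵢ)` odd.
[cite: TianYuanZhang2017, Thm. 1.2 (journal numbering)] [cite: Smith2016CongruentDensity, Thm. 1.2, Thm. 2.2] -/
theorem rank_zero_and_sha_iff_odd_genusSum₁' {N : ℕ} (hN : Squarefree N) (h8 : N % 8 = 1) :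
    ((haveI := isElliptic_congruentNumberCurve (Squarefree.ne_zero hN);
        (congruentNumberCurve N).mordellWeilRank = 0) ∧
      (haveI := isElliptic_congruentNumberCurve (Squarefree.ne_zero hN);
        AddCommGroup.primaryComponent (congruentNumberCurve N).sha 2 = ⊥)) ↔
      Odd (genusSum₁ N fun d => genusClassNumber (GenusField d)) :=
  rank_zero_and_sha_iff_odd_genusSum₁_of_smith' smith_thm22_rowOne_holds hN h8

/-- **`#Sel⁽²⁾(E_N/ℚ) = 4 ⟺ Σ∏g(dᵢ)` odd for every square-free `N ≡ 1 (mod 8)`**, unconditionally.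
[cite: Smith2016CongruentDensity, Thm. 1.2 and Thm. 2.2 (chunk p0005 L59–L75)] -/
theorem card_selmerGroup_two_eq_four_iff_odd_genusSum₁' {N : ℕ} (hN : Squarefree N)
    (h8 : N % 8 = 1) :
    Nat.card ((congruentNumberCurve N).selmerGroup 2) = 4 ↔
      Odd (genusSum₁ N fun d => genusClassNumber (GenusField d)) :=
  card_selmerGroup_two_eq_four_iff_odd_genusSum₁_of_smith' smith_thm22_rowOne_holds hN h8

/-- **Smith 2016, Theorem 1.2 on `n ≡ 1 (mod 8)`, relative to Tian–Yuan–Zhang's Theorem 1.1 ALONE**: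
TYZ's integer `𝓛(n)` is odd iff `#Sel⁽²⁾(E⁽ⁿ⁾/ℚ) = 4`.
[cite: Smith2016CongruentDensity, Thm. 1.2 (chunk p0003 L29–L31)] [cite: TianYuanZhang2017, Thm. 1.1] -/
theorem exists_scriptL_odd_iff_card_selmerGroup_two_eq_four (h11 : thm11_parity_of_scriptL)
    (hp : ∀ i, (p i).Prime) (hodd : ∀ i, Odd (p i)) (hinj : Function.Injective p)
    (h8 : (∏ i, p i) % 8 = 1) :
    ∃ L : ℤ, IsScriptL (∏ i, p i) L ∧
      (Odd L ↔ Nat.card ((congruentNumberCurve (∏ i, p i)).selmerGroup 2) = 4) :=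
  exists_scriptL_odd_iff_card_selmerGroup_two_eq_four_of_smith p h11 smith_thm22_rowOne_holds hp
    hodd hinj h8

end Literature.NumberTheory.EllipticCurves.Smith2016
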